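/-
Copyright (c) 2026. All rights reserved.
Released under Apache 2.0 license as described in the file LICENSE.
-/
import Literature.AlgebraicGeometry.ComplexMultiplication.CyclotomicFermatCMTypesPrimeLevelDegenerate
import Mathlib.RingTheory.Polynomial.Resultant.Basic
import Mathlib.RingTheory.Polynomial.Cyclotomic.Roots
import Mathlib.FieldTheory.IsAlgClosed.Basic
import Mathlib.Analysis.Complex.Polynomial.Basic
import HarnessLib

/-!
# Asymptotic non-degeneracy of the prime-level Fermat CM types `S_k` of `ℚ(ζ_p)`:
# Fité–González–Lario 2016 Prop. 4.11 (`rk(D_k)/r_k → 1`, `N_k → ∞`), Fité–Shparlinski 2016 Thm. 5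
# (`L_{β,m}` finite), §6, and an erratum to Cor. 3 / [FGL] Remark 3.4

Layer `Literature/AlgebraicGeometry/ComplexMultiplication`; sequel of `CyclotomicFermatCMTypesPrimeLevelDegenerate`
(lit-deligne-3 gen 15: Fité–González–Lario Thm. 1.2 = 4.10 — the exact rank of every Fermat CM type
`Φ_{S_k}`, `S_k = {j : ⟨j⟩ + ⟨kj⟩ < p}`, of the `p`-th cyclotomic field; `N_k ≥ 27`; the degenerate primes
below `400`), whose docstring lists «NOT here: … the Lenstra–Stark / Fité–Shparlinski statement …; Prop. 4.11
(`N_k → ∞`) …».  THEOREMS ONLY (no definition, no named fact, no `sorry`).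

## The print

F. Fité, J. González, J.-C. Lario, *Frobenius distribution for quotients of Fermat curves of prime exponent*,
Canad. J. Math. **68** (2016) 361–394 [FiteGonzalezLario2016] (held text `paper:arxiv-1403.0807`, p0014 L72–93):

> "Proposition 4.11. For `ℓ` prime, we have `lim_{ℓ → ∞, 1 ≤ k ≤ ℓ−2} rk(D_k)/r_k = 1`.
> Proof. When `ℓ` is non-degenerate, the quotient `rk(D_k)/r_k = 1` and there is nothing to prove. Since when
> `(ℓ, k)` is degenerate, one has `r_k = (ℓ−1)/2`, by Theorem 4.10 it is enough to show that `N_k → ∞` when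
> `ℓ → ∞` … This immediately follows from the claim that for every `N₀`, the set `S_{N₀}` of degenerate primes
> `ℓ` such that `N₀ = N_k` for some `1 ≤ k ≤ ℓ − 2` has finite cardinality. … `S_{N₀}` is a subset of the set
> of primes dividing the resultant `R_{N₀}` of `p_f(x)` and `q_f(x)`, and therefore it suffices to show that
> `R_{N₀}` is nonzero. This may be deduced from the fact that the roots of `p_f(x)` are unrepeated roots of
> unity, whereas `q_f(x)` has neither double roots nor roots of finite order."

and Remark 3.4 (p0008 L63): "Lenstra and Stark noticed that every sufficiently large prime `ℓ ≡ 7 (mod 12)` is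
degenerate (see [Gre80]). In fact, every prime `ℓ ≡ 7 (mod 12)` distinct from `7` and `19` is degenerate (see
[FS15] …)."  Here `r_k = #(M_k/W_k) = (ℓ−1)/2` for `k` not a primitive cube root of unity, `rk(D_k) = dim Hg(Jac(C_k))
= rank(Φ_{S_k}) − 1` (Lemma 3.3), and Thm. 4.10: `(ℓ, k)` degenerate iff (a) `ord k ≠ 3`, (b) `ord k`,
`ord(−k²−k)` odd, (c) `v₃(ord k) > v₃(ord(−k²−k))`, in which case `rk(D_k) = (ℓ−1)/2 · (1 − 2/N_k)`,
`N_k = lcm(ord(−k²−k), ord k)` — all PROVED in the predecessor file (`isNondegenerate_fermat_iff_orderOf`,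
`cmTypeRank_fermat_eq_ite`, `cmTypeRank_fermat_sub_one_eq_of_degenerate`).

F. Fité, I. E. Shparlinski, *On the singularity of the Demjanenko matrix of quotients of Fermat curves*, Proc. Amer.
Math. Soc. **144** (2016) 55–63 [FiteShparlinski2016] (held text `paper:arxiv-1404.5178`, p0001–p0002, p0008–p0009).
`K_ℓ` := the set of `1 ≤ k ≤ ℓ − 2` for which `D_{k,ℓ}` is singular; Lemma 6 (= [FGL] Thm. 4.10): `k ∈ K_ℓ` iff
(i) `ord k ≠ 3`, (ii) `ν₂(ord k) = ν₂(ord(−k²−k)) = 0`, (iii) `ν₃(ord k) > ν₃(ord(k²+k))`.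

> "Corollary 3. For every prime `ℓ ≡ 7 (mod 12)` distinct from `7` and `19` we have `#K_ℓ > 0`. … A computer
> search establishes that the only primes of this form are `7, 19, 163, 487, 1459, 39367, 86093443, 258280327`.
> Among the above primes, we have `#K_ℓ = 0` only for `ℓ = 7, 19`."
> "Theorem 5. For any fixed `β ≥ 0` and `m ≥ 1` such that `(m, 6) = 1`, the set `L_{β,m}` [of primes
> `ℓ = 2^α 3^β m + 1`, for some `α > 0`, such that `#K_ℓ > 0`] is finite. More precisely, if `β = 0`, then
> `#L_{β,m} = 0` …"
> (§5, proof) "Then `k` is simultaneously a root of `p_{a,d}(X) := Φ_{3^a d}(X)` and `q_{b,e}(X) := Φ_{3^b e}(−X²−X)`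
> modulo `ℓ`. This means that `ℓ` divides the resultant `R_{a,b,d,e} := Res(p_{a,d}, q_{b,e})`. Note that
> `p_{a,d}(X)` and `q_{b,e}(X)` have no roots in common. … if a root of unity plus `1` is again a root of unity,
> then this root of unity is a primitive cubic root of unity. … Hence `R_{a,b,d,e} ≠ 0`."
> (§6) "we also note that `L_{1,1} = L_{2,1} = L_{3,1} = ∅`. … The resultant argument of [FGL] shows that
> `min_{k ∈ K_ℓ} M(k, ℓ) → ∞` as `ℓ → ∞`", `M(k, ℓ) := lcm[ord(−k²−k), ord k]`.

## What is proved (following the printed resultant argument, in Fité–Shparlinski's cyclotomic formulation)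

* §1 `not_isPrimitiveRoot_neg_sq_sub` — over `ℂ`: if `ζ` is a primitive `n₁`-th root of unity, `n₁ ≠ 0, 3`, then
  `−ζ² − ζ` is not a root of unity of any order `n₂ ≠ 0` ("a root of unity plus 1 is a root of unity only for a
  primitive cube root": `|ζ| = |ζ+1| = 1 ⟹ ζ² + ζ + 1 = 0`, the tree's `sq_add_self_add_one_eq_zero_of_norm`).
* §2 **`isCoprime_cyclotomic_comp`**: `Φ_{n₁}(X)` and `Φ_{n₂}(−X² − X)` are coprime in `ℚ[X]` (`n₁ ≠ 0, 3`,
  `n₂ ≠ 0`) — «`p_{a,d}` and `q_{b,e}` have no roots in common» (Mathlib `isCoprime_iff_aeval_ne_zero_of_isAlgClosed`).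
* §3 **`resultant_cyclotomic_comp_ne_zero`** («Hence `R ≠ 0`»: the INTEGER resultant, via Mathlib
  `Polynomial.resultant`, `resultant_map_map`, `resultant_ne_zero`), **`natCast_dvd_resultant_of_orderOf_eq`** («`ℓ`
  divides the resultant»: Bézout `Φ_{n₁}u + Φ_{n₂}(−X²−X)v = Res` in `ℤ[X]`, Mathlib
  `exists_mul_add_mul_eq_C_resultant`,
  evaluated at `k` mod `p`, where `k`, `−k²−k` are roots of `Φ_{ord k}`, `Φ_{ord(−k²−k)}` by `isRoot_cyclotomic_iff`),
  `le_natAbs_resultant_of_orderOf` (`p ≤ |Res(Φ_{ord k}, Φ_{ord(−k²−k)}(−X²−X))|` when `ord k ≠ 3`).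
* §4 **`exists_bound_lt_lcm_orderOf`** = «`N_k → ∞`» / «`min_{k ∈ K_ℓ} M(k,ℓ) → ∞`», UNIFORMLY: for every `N₀`
  there is `B` (a maximum of finitely many resultants) with `lcm(ord(−k²−k), ord k) > N₀` for all primes `p > B`
  and ALL `k ≠ 0, −1` with `ord k ≠ 3` (degenerate or not — slightly more than printed, same proof);
  **`finite_setOf_prime_exists_degenerate_lcm_eq`** = «`S_{N₀}` has finite cardinality» as printed;
  `exists_bound_lt_lcm_orderOf_of_not_isNondegenerate` (the same over the tree's `IsNondegenerate`).
* §5 `cmTypeRank_fermat_sub_one_div_le_one` (`rk(D_k)/r_k ≤ 1`), `cmTypeRank_fermat_sub_one_div_eq_of_degenerate`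
  (`rk(D_k)/r_k = 1 − 2/N_k` over `ℝ`), **`fiteGonzalezLario_prop_4_11`** = PROPOSITION 4.11: for every `ε > 0`
  there is `B` such that `1 − ε < (rank(Φ_{S_k}) − 1)/((p−1)/2) ≤ 1` for all primes `p > B`, all `p`-th
  cyclotomic fields and all `k ≠ 0, −1` with `ord k ≠ 3`; `cmTypeRank_fermat_sub_one_div_eq_one_of_orderOf_eq_three`
  (the pairs with `ord k = 3`, set aside by clause (a): `r_k = (p−1)/6` and the ratio is exactly `1`).
* §6 `lcm_orderOf_dvd_of_sub_one_eq` (`N_k` divides the odd part of `p − 1`), **`fiteShparlinski_thm_5`** =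
  THEOREM 5 (bound form: for `p > B(β, m)` with `p − 1 = 2^α 3^β m` every `Φ_{S_k}` is nondegenerate, i.e.
  `K_p = ∅`), **`finite_setOf_prime_sub_one_eq_exists_degenerate`** (THEOREM 5 literally: `L_{β,m}` finite),
  **`isNondegenerate_fermat_of_sub_one_eq_two_pow_mul`** («if `β = 0` then `#L_{β,m} = 0`»),
  **`isNondegenerate_fermat_of_sub_one_eq_two_pow_mul_three_pow`** (§6: «`L_{1,1} = L_{2,1} = L_{3,1} = ∅`» — every
  prime `2^α 3^β + 1`, `β ≤ 3`, has `K = ∅`; here from `N_k ≥ 27` and `S₂₇ = {271}` of the predecessor file).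
* §7 ERRATUM.  **`isNondegenerate_fermat_of_mem_counterexamples`**: `K_ℓ = ∅` for `ℓ ∈ {31, 43, 79, 103}`, all
  `≡ 7 (mod 12)` — so Corollary 3 of [FiteShparlinski2016] (as printed in arXiv:1404.5178v1, the only arXiv version)
  and the sentence «every prime `ℓ ≡ 7 (mod 12)` distinct from `7` and `19` is degenerate» of [FGL] Remark 3.4
  (arXiv:1403.0807v2 = the revised version of Nov. 2015) are FALSE AS PRINTED
  (`exists_prime_mod_twelve_eq_seven_forall_isNondegenerate`; the arXiv proof of Cor. 3 searches only `m = 1`, i.e.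
  the primes `2·3^β + 1`);
  **`exists_not_isNondegenerate_fermat_iff_of_mod_twelve`** = Cor. 3 CORRECTED below `400`: for a prime
  `p ≡ 7 (mod 12)`, `p < 400`, `K_p ≠ ∅` iff `p = 67` or `p ≥ 127` (exceptions `7, 19, 31, 43, 79, 103`).  Lenstra's
  qualitative observation («`K_ℓ ≠ ∅` for every SUFFICIENTLY LARGE `ℓ ≡ 7 (mod 12)`», [Gre80]) and the asymptotic
  Theorem 1 / Cor. 2 / Thm. 4 of [FS] are untouched by this and NOT formalised (Weil's bound for character sums).
* §8 `exists_not_isNondegenerate_fermat_of_mem_candidates`: of the eight candidate primes `2·3^β + 1` in the proof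
  of Cor. 3, `K_ℓ ≠ ∅` is CERTIFIED for `163, 487, 1459, 39367` (witnesses `k = 21, 16, 1901` for the last three,
  orders `3⁵/3³`, `3⁵/3²`, `3⁹/3²` by `orderOf_eq_prime_pow` + `decide`), and `K_7 = K_19 = ∅`
  (`isNondegenerate_fermat_seven_nineteen`); `86093443`, `258280327` are NOT certified (witness orders `≥ 3¹¹`).

Faithfulness notes. (i) [FGL] phrase the resultant with `p_f = X^{2f} + X^f + 1`, `q_f = ((X+1)^f X^f + 1)/(X²+X+1)`,
`f = N₀/3`; we follow [FS] §5 (`Φ_{n₁}(X)` vs `Φ_{n₂}(−X²−X)`, `n₁ = ord k ≠ 3`, `n₂ = ord(−k²−k)`), which bounds the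
same primes and needs no division by `X² + X + 1`; both papers are cited on the shared statements. (ii) «degenerate
pair `(ℓ, k)`» / «`k ∈ K_ℓ`» = `k ≠ 0, −1 (mod p)`, `ord k ≠ 3` and `¬ IsNondegenerate (Φ_{S_k})` (tree), equivalently
(ii)+(iii) of Lemma 6 (`isNondegenerate_fermat_iff_orderOf`); the set-theoretic finiteness statements are phrased with
(ii)+(iii) so that no cyclotomic field has to be chosen inside a set-builder. (iii) Theorem 5 is proved for every
`m` (the hypothesis `(m, 6) = 1`, `α > 0` is not needed for finiteness; for «`β = 0`» only `3 ∤ m` is used).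
NOT here: [FS] Theorem 1 (the asymptotic count `#K_ℓ ~ ℓ(1 − 3^{−2β})/2^{2α+2}`), Cor. 2, Thm. 4, the quantitative
`O(3^{2β} m²/β)` in Thm. 5 and `min M(k,ℓ) ≥ c√(log ℓ)`; [FGL] Prop. 4.13–4.16 and §5.

## References

* [FiteGonzalezLario2016] F. Fité, J. González, J.-C. Lario, Canad. J. Math. 68 (2016) 361–394 (arXiv:1403.0807):
  Prop. 4.11 (with proof), Remark 3.4, Thm. 4.10, Lemma 3.3, Remark 4.12.
* [FiteShparlinski2016] F. Fité, I. E. Shparlinski, Proc. Amer. Math. Soc. 144 (2016) 55–63 (arXiv:1404.5178):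
  Lemma 6, Cor. 3 (with proof), Thm. 5 (with proof, §5), §6.
* [Greenberg1980] R. Greenberg, Compositio Math. 42 (1980/81) 345–359 (Lenstra–Stark's remark, cited through
  [FGL]/[FS]).

## Provenance

Cell `pub-hodgecm2` (COR-CM), literature seat `lit-deligne-3` gen 16 (claim FGL-ASYMPTOTIC; count-neutral own lane).
-/

noncomputable section

open scoped BigOperators
open Polynomial ComplexConjugate

namespace Literature.AlgebraicGeometry.ComplexMultiplication

open Literature.NumberTheory.ComplexMultiplication
open Literature.AlgebraicGeometry.Motives (CMType)
open Literature.AlgebraicGeometry.HodgeTheory (fermatCMType)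
open Literature.AlgebraicGeometry.Pohlmann1968 Literature.AlgebraicGeometry.Pohlmann1968.Cyclotomic

namespace CyclotomicFermatCMType

/-! ## §1 The root-of-unity lemma over `ℂ` -/

section Complex

/-- If `ζ` is a primitive `n₁`-th root of unity in `ℂ` with `n₁ ≠ 0, 3`, then `−ζ² − ζ = −ζ(ζ + 1)` is not a root
of unity of any order `n₂ ≠ 0` (else `|ζ + 1| = 1`, so `ζ` is a primitive cube root of unity).
[cite: FiteShparlinski2016, §5 (proof of Thm. 5)] -/
theorem not_isPrimitiveRoot_neg_sq_sub {z : ℂ} {n₁ n₂ : ℕ} (hn₁ : n₁ ≠ 0) (h3 : n₁ ≠ 3) (hn₂ : n₂ ≠ 0)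
    (hz : IsPrimitiveRoot z n₁) : ¬ IsPrimitiveRoot (-z ^ 2 - z) n₂ := by
  intro hw
  have hz1 : ‖z‖ = 1 := hz.norm'_eq_one hn₁
  have hw1 : ‖-z ^ 2 - z‖ = 1 := hw.norm'_eq_one hn₂
  have hz2 : ‖z + 1‖ = 1 := by
    have : -z ^ 2 - z = -(z * (z + 1)) := by ring
    rw [this, norm_neg, norm_mul, hz1, one_mul] at hw1
    exact hw1
  have hq := sq_add_self_add_one_eq_zero_of_norm hz1 hz2
  obtain ⟨hz3, hz1'⟩ := (sq_add_self_add_one_eq_zero_iff z).1 hq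
  have hord : orderOf z = 3 := orderOf_eq_prime hz3 hz1'
  exact h3 (hz.eq_orderOf.trans hord)

end Complex

/-! ## §2 Coprimality of `Φ_{n₁}(X)` and `Φ_{n₂}(−X² − X)` over `ℚ` -/

section Coprime

/-- **Fité–Shparlinski, proof of Thm. 5: «`p_{a,d}(X) := Φ_{3^a d}(X)` and `q_{b,e}(X) := Φ_{3^b e}(−X² − X)` have
no roots in common»** — for ALL `n₁ ≠ 0, 3` and `n₂ ≠ 0` the rational polynomials `Φ_{n₁}(X)` and `Φ_{n₂}(−X² − X)`
are coprime (a common complex root `ζ` would be a primitive `n₁`-th root of unity with `−ζ² − ζ` a root of unity).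
[cite: FiteShparlinski2016, §5 (proof of Thm. 5)] -/
theorem isCoprime_cyclotomic_comp {n₁ n₂ : ℕ} (hn₁ : n₁ ≠ 0) (h3 : n₁ ≠ 3) (hn₂ : n₂ ≠ 0) :
    IsCoprime (cyclotomic n₁ ℚ) ((cyclotomic n₂ ℚ).comp (-X ^ 2 - X)) := by
  refine (Polynomial.isCoprime_iff_aeval_ne_zero_of_isAlgClosed (k := ℚ) (K := ℂ) _ _).2 fun z => ?_
  by_contra h
  simp only [not_or, not_not] at h
  obtain ⟨h₁, h₂⟩ := h
  haveI : NeZero (n₁ : ℂ) := ⟨Nat.cast_ne_zero.2 hn₁⟩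
  haveI : NeZero (n₂ : ℂ) := ⟨Nat.cast_ne_zero.2 hn₂⟩
  have hz : IsPrimitiveRoot z n₁ := by
    rw [← isRoot_cyclotomic_iff, IsRoot.def, ← map_cyclotomic n₁ (algebraMap ℚ ℂ), eval_map,
      ← aeval_def]
    exact h₁
  have hw : IsPrimitiveRoot (-z ^ 2 - z) n₂ := by
    rw [← isRoot_cyclotomic_iff, IsRoot.def, ← map_cyclotomic n₂ (algebraMap ℚ ℂ), eval_map,
      ← aeval_def]
    rw [aeval_comp] at h₂
    simpa using h₂
  exact not_isPrimitiveRoot_neg_sq_sub hn₁ h3 hn₂ hz hw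

end Coprime

/-! ## §3 The integer resultant `R(n₁, n₂) = Res(Φ_{n₁}(X), Φ_{n₂}(−X² − X))` -/

section Resultant

/-- **`R(n₁, n₂) := Res_ℤ(Φ_{n₁}(X), Φ_{n₂}(−X² − X)) ≠ 0` for `n₁ ≠ 0, 3`, `n₂ ≠ 0`** (Fité–Shparlinski:
«Hence `R_{a,b,d,e} ≠ 0`»; Fité–González–Lario, proof of Prop. 4.11: «it suffices to show that `R_{N₀}` is
nonzero»). [cite: FiteShparlinski2016, §5 (proof of Thm. 5)] [cite: FiteGonzalezLario2016, Prop. 4.11 (proof)] -/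
theorem resultant_cyclotomic_comp_ne_zero {n₁ n₂ : ℕ} (hn₁ : n₁ ≠ 0) (h3 : n₁ ≠ 3) (hn₂ : n₂ ≠ 0) :
    resultant (cyclotomic n₁ ℤ) ((cyclotomic n₂ ℤ).comp (-X ^ 2 - X)) ≠ 0 := by
  intro h
  have hne := resultant_ne_zero _ _ (isCoprime_cyclotomic_comp hn₁ h3 hn₂)
  apply hne
  have hinj : Function.Injective (Int.castRingHom ℚ) := (Int.castRingHom ℚ).injective_int
  have hm₁ : cyclotomic n₁ ℚ = (cyclotomic n₁ ℤ).map (Int.castRingHom ℚ) := (map_cyclotomic_int n₁ ℚ).symm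
  have hm₂ : (cyclotomic n₂ ℚ).comp (-X ^ 2 - X) =
      ((cyclotomic n₂ ℤ).comp (-X ^ 2 - X)).map (Int.castRingHom ℚ) := by
    rw [Polynomial.map_comp, map_cyclotomic_int]
    simp
  rw [hm₁, hm₂, natDegree_map_eq_of_injective hinj, natDegree_map_eq_of_injective hinj,
    resultant_map_map, h, map_zero]

variable {p : ℕ} [hp : Fact p.Prime]

/-- The order of a non-zero residue mod `p` is positive. [folklore] -/
private theorem orderOf_pos_of_ne_zero {a : ZMod p} (ha : a ≠ 0) : 0 < orderOf a := by
  have : a = ((Units.mk0 a ha : (ZMod p)ˣ) : ZMod p) := rfl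
  rw [this, orderOf_units]
  exact orderOf_pos _

/-- **The prime `p` divides `R(ord k, ord(−k² − k))`** (Fité–Shparlinski, proof of Thm. 5: «`k` is simultaneously a
root of `p_{a,d}(X)` and `q_{b,e}(X)` modulo `ℓ`. This means that `ℓ` divides the resultant»; Fité–González–Lario,
proof of Prop. 4.11: «`S_{N₀}` is a subset of the set of primes dividing the resultant»): for `k ∈ (ℤ/p)`,
`k ≠ 0`, `−k² − k ≠ 0`, with `ord k = n₁`, `ord(−k² − k) = n₂`, `p ∣ Res_ℤ(Φ_{n₁}(X), Φ_{n₂}(−X² − X))` — by a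
Bézout identity `Φ_{n₁}u + Φ_{n₂}(−X²−X)v = R` in `ℤ[X]` (Mathlib `exists_mul_add_mul_eq_C_resultant`) evaluated
at `k` modulo `p`.
[cite: FiteShparlinski2016, §5 (proof of Thm. 5)] [cite: FiteGonzalezLario2016, Prop. 4.11 (proof)] -/
theorem natCast_dvd_resultant_of_orderOf_eq {a : ZMod p} (ha : a ≠ 0) (hb : -a ^ 2 - a ≠ 0) :
    (p : ℤ) ∣ resultant (cyclotomic (orderOf a) ℤ) ((cyclotomic (orderOf (-a ^ 2 - a)) ℤ).comp (-X ^ 2 - X)) := by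
  set n₁ := orderOf a with hn₁def
  set n₂ := orderOf (-a ^ 2 - a) with hn₂def
  set P₁ := cyclotomic n₁ ℤ with hP₁
  set P₂ := (cyclotomic n₂ ℤ).comp (-X ^ 2 - X) with hP₂
  have hn₁ : 0 < n₁ := orderOf_pos_of_ne_zero ha
  have hn₂ : 0 < n₂ := orderOf_pos_of_ne_zero hb
  have hp₁ : ¬ p ∣ n₁ := fun hdvd => by
    have h1 := Nat.le_of_dvd hn₁ hdvd
    have h2 := Nat.le_of_dvd (by have := hp.out.two_le; omega) (ZMod.orderOf_dvd_card_sub_one ha)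
    omega
  have hp₂ : ¬ p ∣ n₂ := fun hdvd => by
    have h1 := Nat.le_of_dvd hn₂ hdvd
    have h2 := Nat.le_of_dvd (by have := hp.out.two_le; omega) (ZMod.orderOf_dvd_card_sub_one hb)
    omega
  haveI : NeZero (n₁ : ZMod p) := ⟨by rw [Ne, ZMod.natCast_eq_zero_iff]; exact hp₁⟩
  haveI : NeZero (n₂ : ZMod p) := ⟨by rw [Ne, ZMod.natCast_eq_zero_iff]; exact hp₂⟩
  have hdeg : P₁.natDegree ≠ 0 := by
    rw [hP₁, natDegree_cyclotomic]
    exact (Nat.totient_pos.2 hn₁).ne'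
  obtain ⟨u, v, -, -, huv⟩ := exists_mul_add_mul_eq_C_resultant P₁ P₂ le_rfl le_rfl (Or.inl hdeg)
  have r₁ : eval a (P₁.map (Int.castRingHom (ZMod p))) = 0 := by
    rw [hP₁, map_cyclotomic_int, ← IsRoot.def, isRoot_cyclotomic_iff]
    exact IsPrimitiveRoot.orderOf a
  have r₂ : eval a (P₂.map (Int.castRingHom (ZMod p))) = 0 := by
    rw [hP₂, Polynomial.map_comp, map_cyclotomic_int, eval_comp]
    have hev : eval a (Polynomial.map (Int.castRingHom (ZMod p)) (-X ^ 2 - X)) = -a ^ 2 - a := by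
      simp
    rw [hev, ← IsRoot.def, isRoot_cyclotomic_iff]
    exact IsPrimitiveRoot.orderOf _
  have key : eval a ((P₁ * u + P₂ * v).map (Int.castRingHom (ZMod p))) =
      eval a ((C (resultant P₁ P₂)).map (Int.castRingHom (ZMod p))) := by rw [huv]
  rw [Polynomial.map_C, eval_C, Polynomial.map_add, Polynomial.map_mul, Polynomial.map_mul, eval_add,
    eval_mul, eval_mul, r₁, r₂, zero_mul, zero_mul, zero_add, eq_intCast] at key
  exact (ZMod.intCast_zmod_eq_zero_iff_dvd _ p).1 key.symm

/-- Consequently `p ≤ |R(ord k, ord(−k² − k))|` whenever `ord k ≠ 3` (the resultant is then non-zero).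
[cite: FiteShparlinski2016, §5 (proof of Thm. 5)] -/
theorem le_natAbs_resultant_of_orderOf {a : ZMod p} (ha : a ≠ 0) (hb : -a ^ 2 - a ≠ 0) (h3 : orderOf a ≠ 3) :
    p ≤ (resultant (cyclotomic (orderOf a) ℤ)
      ((cyclotomic (orderOf (-a ^ 2 - a)) ℤ).comp (-X ^ 2 - X))).natAbs := by
  have hn₁ : orderOf a ≠ 0 := (orderOf_pos_of_ne_zero ha).ne'
  have hn₂ : orderOf (-a ^ 2 - a) ≠ 0 := (orderOf_pos_of_ne_zero hb).ne'
  have hR := resultant_cyclotomic_comp_ne_zero hn₁ h3 hn₂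
  have hdvd := natCast_dvd_resultant_of_orderOf_eq ha hb
  have := Int.natAbs_dvd_natAbs.2 hdvd
  rw [Int.natAbs_natCast] at this
  exact Nat.le_of_dvd (Int.natAbs_pos.2 hR) this

end Resultant


/-! ## §4 `N_k → ∞`: above a resultant bound no `k ≠ 0, −1` with `ord k ≠ 3` has small `lcm(ord(−k²−k), ord k)` -/

section Divergence

variable {p : ℕ} [hp : Fact p.Prime]

/-- `−k² − k = −k(k + 1) ≠ 0` for `k ≠ 0, −1`. [folklore] -/
private theorem neg_sq_sub_ne_zero' {a : ZMod p} (ha : a ≠ 0) (ha1 : 1 + a ≠ 0) : -a ^ 2 - a ≠ 0 := by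
  have : -a ^ 2 - a = -(a * (1 + a)) := by ring
  rw [this, neg_ne_zero]
  exact mul_ne_zero ha ha1

/-- `k ≠ 0, −1` forces `p ≠ 2`. [folklore] -/
private theorem ne_two_of_ne_zero'' {a : ZMod p} (ha : a ≠ 0) (ha1 : 1 + a ≠ 0) : p ≠ 2 := by
  rintro rfl
  have h1 : a = 1 := by simpa using ZMod.pow_card_sub_one_eq_one ha
  have h2 : (2 : ZMod 2) = 0 := by exact_mod_cast ZMod.natCast_self 2
  exact ha1 (by rw [h1, one_add_one_eq_two, h2])

omit hp in
/-- **`N_k → ∞` (Fité–González–Lario, proof of Prop. 4.11: «it is enough to show that `N_k → ∞` when `ℓ → ∞` …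
for every `N₀`, the set `S_{N₀}` … has finite cardinality»; Fité–Shparlinski §6: «the resultant argument of [FGL]
shows that `min_{k ∈ K_ℓ} M(k, ℓ) → ∞` as `ℓ → ∞`»), UNIFORM FORM.** For every `N₀` there is a bound `B` (a
maximum of the resultants `|Res_ℤ(Φ_{n₁}(X), Φ_{n₂}(−X²−X))|`, `n₁, n₂ ≤ N₀`, `n₁ ≠ 3`) such that for every
prime `p > B` and EVERY residue `k ≠ 0, −1 (mod p)` that is not a primitive cube root of unity,
`lcm(ord(−k² − k), ord k) > N₀` — degenerate or not: `k` and `−k² − k` cannot both be roots of unity of small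
order modulo a large prime. [cite: FiteGonzalezLario2016, Prop. 4.11 (proof)] [cite: FiteShparlinski2016, §5–§6] -/
theorem exists_bound_lt_lcm_orderOf (N₀ : ℕ) : ∃ B : ℕ, ∀ (p : ℕ) [Fact p.Prime], B < p →
    ∀ a : ZMod p, a ≠ 0 → 1 + a ≠ 0 → orderOf a ≠ 3 →
      N₀ < Nat.lcm (orderOf (-a ^ 2 - a)) (orderOf a) := by
  classical
  refine ⟨((Finset.range (N₀ + 1)) ×ˢ (Finset.range (N₀ + 1))).sup
      (fun q : ℕ × ℕ => (resultant (cyclotomic q.1 ℤ) ((cyclotomic q.2 ℤ).comp (-X ^ 2 - X))).natAbs), ?_⟩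
  intro p _ hB a ha ha1 h3
  by_contra hN
  rw [not_lt] at hN
  have hb : -a ^ 2 - a ≠ 0 := neg_sq_sub_ne_zero' ha ha1
  have hpos : 0 < Nat.lcm (orderOf (-a ^ 2 - a)) (orderOf a) :=
    Nat.lcm_pos (orderOf_pos_of_ne_zero hb) (orderOf_pos_of_ne_zero ha)
  have h₁ : orderOf a ≤ N₀ := le_trans (Nat.le_of_dvd hpos (Nat.dvd_lcm_right _ _)) hN
  have h₂ : orderOf (-a ^ 2 - a) ≤ N₀ := le_trans (Nat.le_of_dvd hpos (Nat.dvd_lcm_left _ _)) hN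
  have hmem : (orderOf a, orderOf (-a ^ 2 - a)) ∈ (Finset.range (N₀ + 1)) ×ˢ (Finset.range (N₀ + 1)) := by
    simp only [Finset.mem_product, Finset.mem_range]
    omega
  have hle := Finset.le_sup
    (f := fun q : ℕ × ℕ => (resultant (cyclotomic q.1 ℤ) ((cyclotomic q.2 ℤ).comp (-X ^ 2 - X))).natAbs) hmem
  have hp_le := le_natAbs_resultant_of_orderOf ha hb h3
  exact absurd (lt_of_le_of_lt (hp_le.trans hle) hB) (lt_irrefl _)

omit hp in
/-- **Finiteness of `S_{N₀}` in the characterisation language** (Fité–González–Lario, proof of Prop. 4.11: «the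
set `S_{N₀}` of degenerate primes `ℓ` such that `N₀ = N_k` for some `1 ≤ k ≤ ℓ − 2` has finite cardinality»;
Fité–Shparlinski Lemma 6 = [FGL] Thm. 4.10 for the meaning of "degenerate": (i) `ord k ≠ 3`, (ii) `ord k`,
`ord(−k²−k)` odd, (iii) `v₃(ord k) > v₃(ord(−k²−k))`): the set of primes `p` admitting `k ≠ 0, −1` with
`ord k ≠ 3`, (ii), (iii) and `lcm(ord(−k²−k), ord k) = N₀` is finite.
[cite: FiteGonzalezLario2016, Prop. 4.11 (proof)] [cite: FiteShparlinski2016, Lemma 6] -/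
theorem finite_setOf_prime_exists_degenerate_lcm_eq (N₀ : ℕ) :
    {p : ℕ | ∃ (_ : p.Prime), ∃ a : ZMod p, a ≠ 0 ∧ 1 + a ≠ 0 ∧ orderOf a ≠ 3 ∧
      (Odd (orderOf (-a ^ 2 - a)) ∧ Odd (orderOf a) ∧
        padicValNat 3 (orderOf (-a ^ 2 - a)) < padicValNat 3 (orderOf a)) ∧
      Nat.lcm (orderOf (-a ^ 2 - a)) (orderOf a) = N₀}.Finite := by
  obtain ⟨B, hB⟩ := exists_bound_lt_lcm_orderOf N₀
  refine (Set.finite_Iic B).subset ?_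
  rintro p ⟨hp', a, ha, ha1, h3, -, hN⟩
  simp only [Set.mem_Iic]
  by_contra hlt
  rw [not_le] at hlt
  haveI := Fact.mk hp'
  have := hB p hlt a ha ha1 h3
  omega

variable (L : Type) [Field L] [NumberField L] [IsCyclotomicExtension {p} ℚ L]

omit hp L in
/-- **`N_k → ∞` over the DEGENERATE pairs, in the tree's language** (the statement used in the proof of
Prop. 4.11; Fité–Shparlinski §6 «`min_{k ∈ K_ℓ} M(k, ℓ) → ∞`», `M(k, ℓ) := lcm[ord(−k²−k), ord k]`): for every
`N₀` there is `B` such that for all primes `p > B`, every DEGENERATE Fermat type `Φ_{S_k}` of the `p`-th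
cyclotomic field (`k ≠ 0, −1`, `ord k ≠ 3`) has `N_k = lcm(ord(−k²−k), ord k) > N₀`.
[cite: FiteGonzalezLario2016, Prop. 4.11 (proof)] [cite: FiteShparlinski2016, §6] -/
theorem exists_bound_lt_lcm_orderOf_of_not_isNondegenerate (N₀ : ℕ) : ∃ B : ℕ, ∀ (p : ℕ) [Fact p.Prime]
    (L : Type) [Field L] [NumberField L] [IsCyclotomicExtension {p} ℚ L], B < p →
    ∀ (a : ZMod p) (ha : a ≠ 0) (ha1 : 1 + a ≠ 0), orderOf a ≠ 3 →
      ¬ IsNondegenerate (cmTypeOfResidues (L := L) (fermatCMType p 1 a (-1 - a)) (fermatCMType_one_cm ha ha1)) →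
      N₀ < Nat.lcm (orderOf (-a ^ 2 - a)) (orderOf a) := by
  obtain ⟨B, hB⟩ := exists_bound_lt_lcm_orderOf N₀
  exact ⟨B, fun p _ L _ _ _ hlt a ha ha1 h3 _ => hB p hlt a ha ha1 h3⟩

end Divergence

/-! ## §5 Fité–González–Lario Proposition 4.11: `rk(D_k)/r_k → 1` -/

section Proposition411

variable {p : ℕ} [hp : Fact p.Prime] (L : Type) [Field L] [NumberField L] [IsCyclotomicExtension {p} ℚ L]

/-- The cast of `r_k = (p − 1)/2` for an odd prime: `((p − 1)/2 : ℕ) = ((p : ℝ) − 1)/2`. [folklore] -/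
private theorem cast_sub_one_div_two (hp2 : p ≠ 2) : (((p - 1) / 2 : ℕ) : ℝ) = ((p : ℝ) - 1) / 2 := by
  obtain ⟨r, hr⟩ := even_iff_two_dvd.1 (hp.out.even_sub_one hp2)
  have hp1 : 1 ≤ p := hp.out.one_lt.le
  rw [hr, Nat.mul_div_cancel_left r two_pos]
  have : ((p : ℝ) - 1) = ((p - 1 : ℕ) : ℝ) := by rw [Nat.cast_sub hp1, Nat.cast_one]
  rw [this, hr, Nat.cast_mul, Nat.cast_ofNat]
  ring

/-- **The ratio `rk(D_k)/r_k` is at most `1`** (`rank(Φ_{S_k}) − 1 ≤ (p − 1)/2`; Kubota / Dodson Thm. 1.0 (ii),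
FGL Lemma 3.3). [cite: FiteGonzalezLario2016, Lemma 3.3 and Thm. 4.10] -/
theorem cmTypeRank_fermat_sub_one_div_le_one {a : ZMod p} (ha : a ≠ 0) (ha1 : 1 + a ≠ 0)
    {hS : ∀ c : ZMod p, c.val.Coprime p → (c ∈ fermatCMType p 1 a (-1 - a) ↔ -c ∉ fermatCMType p 1 a (-1 - a))} :
    ((cmTypeRank (cmTypeOfResidues (L := L) (fermatCMType p 1 a (-1 - a)) hS) : ℝ) - 1) /
        (((p : ℝ) - 1) / 2) ≤ 1 := by
  have hp2 := ne_two_of_ne_zero'' ha ha1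
  have hp3 : 3 ≤ p := by
    have := hp.out.two_le
    omega
  have hpos : 0 < ((p : ℝ) - 1) / 2 := by
    have : (3 : ℝ) ≤ p := by exact_mod_cast hp3
    linarith
  rw [div_le_one hpos, ← cast_sub_one_div_two hp2, cmTypeRank_fermat_eq_ite L ha ha1]
  push_cast [Nat.cast_add]
  have hle : ((p - 1) / 2 - (if Odd (orderOf (-a ^ 2 - a)) ∧ Odd (orderOf a) ∧
      padicValNat 3 (orderOf (-a ^ 2 - a)) < padicValNat 3 (orderOf a)
      then (p - 1) / Nat.lcm (orderOf (-a ^ 2 - a)) (orderOf a) else 0) : ℕ) ≤ (p - 1) / 2 := Nat.sub_le _ _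
  have hcast := (Nat.cast_le (α := ℝ)).2 hle
  linarith

/-- **The ratio in the degenerate case, verbatim: `rk(D_k)/r_k = 1 − 2/N_k`** (Thm. 4.10: «`rk(D_k) =
(ℓ−1)/2 · (1 − 2/N_k)`», `r_k = (ℓ−1)/2`; Fité–Shparlinski §6). [cite: FiteGonzalezLario2016, Thm. 4.10]
[cite: FiteShparlinski2016, §6] -/
theorem cmTypeRank_fermat_sub_one_div_eq_of_degenerate {a : ZMod p} (ha : a ≠ 0) (ha1 : 1 + a ≠ 0)
    (hb : Odd (orderOf (-a ^ 2 - a)) ∧ Odd (orderOf a))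
    (hc : padicValNat 3 (orderOf (-a ^ 2 - a)) < padicValNat 3 (orderOf a))
    {hS : ∀ c : ZMod p, c.val.Coprime p → (c ∈ fermatCMType p 1 a (-1 - a) ↔ -c ∉ fermatCMType p 1 a (-1 - a))} :
    ((cmTypeRank (cmTypeOfResidues (L := L) (fermatCMType p 1 a (-1 - a)) hS) : ℝ) - 1) /
        (((p : ℝ) - 1) / 2) = 1 - 2 / Nat.lcm (orderOf (-a ^ 2 - a)) (orderOf a) := by
  have hp2 := ne_two_of_ne_zero'' ha ha1
  have hp3 : 3 ≤ p := by
    have := hp.out.two_le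
    omega
  have hpos : 0 < ((p : ℝ) - 1) / 2 := by
    have : (3 : ℝ) ≤ p := by exact_mod_cast hp3
    linarith
  have hq := cmTypeRank_fermat_sub_one_eq_of_degenerate L ha ha1 hb hc (hS := hS)
  have hr := congr_arg (fun q : ℚ => (q : ℝ)) hq
  push_cast at hr
  rw [hr, mul_div_cancel_left₀ _ hpos.ne']

omit hp L in
/-- **Fité–González–Lario 2016, PROPOSITION 4.11 («The rank of `D_k` is "asymptotically non-degenerate"»):
«For `ℓ` prime, we have `lim_{ℓ → ∞, 1 ≤ k ≤ ℓ−2} rk(D_k)/r_k = 1`.»** In the tree's language (`rk(D_k) =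
rank(Φ_{S_k}) − 1`, Lemma 3.3; `r_k = (ℓ − 1)/2` for `k` not a primitive cube root of unity, clause (a)): for every
`ε > 0` there is `B` such that for every prime `p > B`, every `p`-th cyclotomic field `L` and every `k ≠ 0, −1`
with `ord k ≠ 3`, `1 − ε < (rank(Φ_{S_k}) − 1)/((p − 1)/2) ≤ 1`.  (For `ord k = 3` the type is induced from the
index-`3` subfield, `rank − 1 = (p−1)/6 = r_k` exactly: `cmTypeRank_fermat_of_pow_three_eq_one`.)  Proof as
printed: nondegenerate pairs have ratio `1`; degenerate ones have ratio `1 − 2/N_k` and `N_k → ∞` (§4).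
[cite: FiteGonzalezLario2016, Prop. 4.11] -/
theorem fiteGonzalezLario_prop_4_11 (ε : ℝ) (hε : 0 < ε) : ∃ B : ℕ, ∀ (p : ℕ) [Fact p.Prime]
    (L : Type) [Field L] [NumberField L] [IsCyclotomicExtension {p} ℚ L], B < p →
    ∀ (a : ZMod p) (ha : a ≠ 0) (ha1 : 1 + a ≠ 0), orderOf a ≠ 3 →
      1 - ε < ((cmTypeRank (cmTypeOfResidues (L := L) (fermatCMType p 1 a (-1 - a))
          (fermatCMType_one_cm ha ha1)) : ℝ) - 1) / (((p : ℝ) - 1) / 2) ∧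
      ((cmTypeRank (cmTypeOfResidues (L := L) (fermatCMType p 1 a (-1 - a))
          (fermatCMType_one_cm ha ha1)) : ℝ) - 1) / (((p : ℝ) - 1) / 2) ≤ 1 := by
  obtain ⟨B, hB⟩ := exists_bound_lt_lcm_orderOf ⌈2 / ε⌉₊
  refine ⟨B, fun p _ L _ _ _ hlt a ha ha1 h3 => ⟨?_, cmTypeRank_fermat_sub_one_div_le_one L ha ha1⟩⟩
  by_cases hcond : Odd (orderOf (-a ^ 2 - a)) ∧ Odd (orderOf a) ∧
      padicValNat 3 (orderOf (-a ^ 2 - a)) < padicValNat 3 (orderOf a)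
  · rw [cmTypeRank_fermat_sub_one_div_eq_of_degenerate L ha ha1 ⟨hcond.1, hcond.2.1⟩ hcond.2.2]
    have hN := hB p hlt a ha ha1 h3
    set N := Nat.lcm (orderOf (-a ^ 2 - a)) (orderOf a) with hNdef
    have hNpos : (0 : ℝ) < N := by exact_mod_cast (Nat.zero_le _).trans_lt hN
    have hNgt : 2 / ε < N := lt_of_le_of_lt (Nat.le_ceil _) (by exact_mod_cast hN)
    have h2N : 2 / (N : ℝ) < ε := by
      rw [div_lt_iff₀ hNpos]
      rw [div_lt_iff₀ hε] at hNgt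
      linarith
    linarith
  · have hp2 : p ≠ 2 := ne_two_of_ne_zero'' ha ha1
    have hp3 : 3 ≤ p := by
      have := (Fact.out : p.Prime).two_le
      omega
    have hpos : 0 < ((p : ℝ) - 1) / 2 := by
      have : (3 : ℝ) ≤ p := by exact_mod_cast hp3
      linarith
    rw [cmTypeRank_fermat_eq_of_not L ha ha1 hcond]
    push_cast
    rw [cast_sub_one_div_two hp2, add_sub_cancel_left, div_self hpos.ne']
    linarith

/-- **The pairs set aside by clause (a)** (`k` a primitive cube root of unity: `W_k = {1, k, k²}`, `D_k` is the
reduced matrix of size `r_k = #(M_k/W_k) = (ℓ−1)/6` and is non-singular, Thm. 4.10): there the ratio is EXACTLY `1`,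
`rank(Φ_{S_k}) − 1 = (p − 1)/6 = r_k` (tree `cmTypeRank_fermat_of_pow_three_eq_one`), so Prop. 4.11's limit over
ALL `1 ≤ k ≤ ℓ − 2` reduces to `fiteGonzalezLario_prop_4_11`. [cite: FiteGonzalezLario2016, Prop. 4.11 and Thm. 4.10] -/
theorem cmTypeRank_fermat_sub_one_div_eq_one_of_orderOf_eq_three {a : ZMod p} (ha : a ≠ 0) (ha1 : 1 + a ≠ 0)
    (h3 : orderOf a = 3)
    {hS : ∀ c : ZMod p, c.val.Coprime p → (c ∈ fermatCMType p 1 a (-1 - a) ↔ -c ∉ fermatCMType p 1 a (-1 - a))} :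
    ((cmTypeRank (cmTypeOfResidues (L := L) (fermatCMType p 1 a (-1 - a)) hS) : ℝ) - 1) /
        (((p : ℝ) - 1) / 6) = 1 := by
  have ha3 : a ^ 3 = 1 := by rw [← h3]; exact pow_orderOf_eq_one a
  have ha1' : a ≠ 1 := by
    rintro rfl
    rw [orderOf_one] at h3
    exact absurd h3 (by norm_num)
  have hp2 := ne_two_of_ne_zero'' ha ha1
  have h31 : 3 ∣ p - 1 := h3 ▸ ZMod.orderOf_dvd_card_sub_one ha
  have h21 : 2 ∣ p - 1 := even_iff_two_dvd.1 (hp.out.even_sub_one hp2)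
  have h61 : 6 ∣ p - 1 := by
    have := Nat.Coprime.mul_dvd_of_dvd_of_dvd (by norm_num : Nat.Coprime 2 3) h21 h31
    simpa using this
  obtain ⟨r, hr⟩ := h61
  have hp1 : 1 ≤ p := hp.out.one_lt.le
  have hr0 : 0 < r := by
    rcases Nat.eq_zero_or_pos r with rfl | h
    · have := hp.out.two_le
      omega
    · exact h
  rw [cmTypeRank_fermat_of_pow_three_eq_one L ha3 ha1', hr, Nat.mul_div_cancel_left r (by norm_num : 0 < 6)]
  have hcast : ((p : ℝ) - 1) = ((p - 1 : ℕ) : ℝ) := by rw [Nat.cast_sub hp1, Nat.cast_one]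
  rw [hcast, hr]
  push_cast
  have hr' : (0 : ℝ) < r := by exact_mod_cast hr0
  field_simp
  ring

end Proposition411

/-! ## §6 Fité–Shparlinski 2016, Theorem 5: `L_{β,m}` is finite; `L_{0,m} = ∅` -/

section FiteShparlinski

variable {p : ℕ} [hp : Fact p.Prime] (L : Type) [Field L] [NumberField L] [IsCyclotomicExtension {p} ℚ L]

/-- The `lcm` of two odd numbers is odd. [folklore] -/
private theorem odd_lcm {b c : ℕ} (hb : Odd b) (hc : Odd c) : Odd (Nat.lcm b c) := by
  rw [← Nat.not_even_iff_odd, even_iff_two_dvd]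
  intro h2
  rcases (Nat.Prime.dvd_mul Nat.prime_two).1 (dvd_trans h2 (Nat.lcm_dvd_mul b c)) with h | h
  · exact (Nat.not_even_iff_odd.2 hb) (even_iff_two_dvd.2 h)
  · exact (Nat.not_even_iff_odd.2 hc) (even_iff_two_dvd.2 h)

/-- For a degenerate pair, `N_k = lcm(ord(−k²−k), ord k)` is ODD and divides the odd part of `p − 1`: if
`p − 1 = 2^α · M` then `N_k ∣ M` (Fité–Shparlinski, proof of Thm. 5: «`ord k = 3^a d`, `ord(−k²−k) = 3^b e` …
`d, e` are divisors of `m`»). [cite: FiteShparlinski2016, §5 (proof of Thm. 5)] -/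
theorem lcm_orderOf_dvd_of_sub_one_eq {a : ZMod p} (ha : a ≠ 0) (ha1 : 1 + a ≠ 0)
    (hb : Odd (orderOf (-a ^ 2 - a)) ∧ Odd (orderOf a)) {α M : ℕ} (hM : p - 1 = 2 ^ α * M) :
    Nat.lcm (orderOf (-a ^ 2 - a)) (orderOf a) ∣ M := by
  have hdvd := lcm_orderOf_dvd_sub_one ha ha1
  rw [hM, mul_comm] at hdvd
  exact (Nat.Coprime.pow_right α (Nat.coprime_two_right.2 (odd_lcm hb.1 hb.2))).dvd_of_dvd_mul_right hdvd

omit hp L in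
/-- **Fité–Shparlinski 2016, THEOREM 5 (first part): «For any fixed `β ≥ 0` and `m ≥ 1` such that `(m, 6) = 1`,
the set `L_{β,m}` is finite»** — `L_{β,m}` = the primes `ℓ = 2^α 3^β m + 1` (`α > 0`) with `#K_ℓ > 0`, `K_ℓ` =
the `k ∈ [1, ℓ−2]` with `D_{k,ℓ}` singular = (Lemma 6 = [FGL] Thm. 4.10) the `k` with `ord k ≠ 3` and `Φ_{S_k}`
DEGENERATE.  Tree form (slightly more general: any `m ≥ 1`, any `α`): there is `B` such that for every prime
`p > B` with `p − 1 = 2^α 3^β m` EVERY Fermat type `Φ_{S_k}` (`k ≠ 0, −1`, `ord k ≠ 3`) of the `p`-th cyclotomic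
field is nondegenerate — since a degenerate `k` has `N_k ∣ 3^β m` (§6) but `N_k → ∞` (§4).
[cite: FiteShparlinski2016, Thm. 5] -/
theorem fiteShparlinski_thm_5 (β m : ℕ) : ∃ B : ℕ, ∀ (p : ℕ) [Fact p.Prime]
    (L : Type) [Field L] [NumberField L] [IsCyclotomicExtension {p} ℚ L], B < p →
    (∃ α : ℕ, p - 1 = 2 ^ α * 3 ^ β * m) →
    ∀ (a : ZMod p) (ha : a ≠ 0) (ha1 : 1 + a ≠ 0), orderOf a ≠ 3 →
      IsNondegenerate (cmTypeOfResidues (L := L) (fermatCMType p 1 a (-1 - a)) (fermatCMType_one_cm ha ha1)) := by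
  obtain ⟨B, hB⟩ := exists_bound_lt_lcm_orderOf (3 ^ β * m)
  refine ⟨B, fun p _ L _ _ _ hlt ⟨α, hα⟩ a ha ha1 h3 => ?_⟩
  rw [isNondegenerate_fermat_iff_orderOf L ha ha1]
  intro hcond
  have hN := hB p hlt a ha ha1 h3
  have hp1 : 0 < p - 1 := by
    have := (Fact.out : p.Prime).two_le
    omega
  have hm : 0 < 3 ^ β * m := by
    rcases Nat.eq_zero_or_pos m with rfl | hm
    · rw [mul_zero] at hα
      omega
    · positivity
  have hdvd := lcm_orderOf_dvd_of_sub_one_eq ha ha1 ⟨hcond.1, hcond.2.1⟩ (α := α) (M := 3 ^ β * m)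
    (by rw [hα, mul_assoc])
  exact absurd (Nat.le_of_dvd hm hdvd) (not_le.2 hN)

omit hp L in
/-- **Theorem 5, literal form: `L_{β,m}` is a finite set of primes** (`L_{β,m}` = the primes `ℓ` with
`ℓ − 1 = 2^α 3^β m` for some `α > 0` and `#K_ℓ > 0`, `K_ℓ` described by Lemma 6 (i)–(iii)).
[cite: FiteShparlinski2016, Thm. 5 and Lemma 6] -/
theorem finite_setOf_prime_sub_one_eq_exists_degenerate (β m : ℕ) :
    {p : ℕ | ∃ (_ : p.Prime), (∃ α : ℕ, 0 < α ∧ p - 1 = 2 ^ α * 3 ^ β * m) ∧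
      ∃ a : ZMod p, a ≠ 0 ∧ 1 + a ≠ 0 ∧ orderOf a ≠ 3 ∧
        Odd (orderOf (-a ^ 2 - a)) ∧ Odd (orderOf a) ∧
        padicValNat 3 (orderOf (-a ^ 2 - a)) < padicValNat 3 (orderOf a)}.Finite := by
  obtain ⟨B, hB⟩ := exists_bound_lt_lcm_orderOf (3 ^ β * m)
  refine (Set.finite_Iic B).subset ?_
  rintro p ⟨hp', ⟨α, -, hα⟩, a, ha, ha1, h3, hodd₁, hodd₂, hv⟩
  simp only [Set.mem_Iic]
  by_contra hlt
  rw [not_le] at hlt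
  haveI := Fact.mk hp'
  have hN := hB p hlt a ha ha1 h3
  have hm : 0 < 3 ^ β * m := by
    rcases Nat.eq_zero_or_pos m with rfl | hm
    · rw [mul_zero] at hα
      have := hp'.two_le
      omega
    · positivity
  have hdvd := lcm_orderOf_dvd_of_sub_one_eq ha ha1 ⟨hodd₁, hodd₂⟩ (α := α) (M := 3 ^ β * m)
    (by rw [hα, mul_assoc])
  exact absurd (Nat.le_of_dvd hm hdvd) (not_le.2 hN)

/-- **Fité–Shparlinski 2016, THEOREM 5 (second part): «if `β = 0`, then `#L_{β,m} = 0`»** (with `(m, 6) = 1`;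
here only `3 ∤ m` is used): if `p − 1 = 2^α m` with `3 ∤ m`, EVERY `Φ_{S_k}` (`k ≠ 0, −1`) is nondegenerate —
condition (iii) forces `3 ∣ ord k ∣ p − 1` ([FGL] Remark 3.4: «any prime `ℓ ≡ 2 (mod 3)` is non-degenerate»).
[cite: FiteShparlinski2016, Thm. 5] [cite: FiteGonzalezLario2016, Remark 3.4] -/
theorem isNondegenerate_fermat_of_sub_one_eq_two_pow_mul {a : ZMod p} (ha : a ≠ 0) (ha1 : 1 + a ≠ 0)
    {α m : ℕ} (hm : ¬ 3 ∣ m) (hα : p - 1 = 2 ^ α * m)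
    {hS : ∀ c : ZMod p, c.val.Coprime p → (c ∈ fermatCMType p 1 a (-1 - a) ↔ -c ∉ fermatCMType p 1 a (-1 - a))} :
    IsNondegenerate (cmTypeOfResidues (L := L) (fermatCMType p 1 a (-1 - a)) hS) := by
  rw [isNondegenerate_fermat_iff_orderOf L ha ha1]
  intro hcond
  have h3 := (three_dvd_orderOf_of_padicValNat_lt ha hcond.2.2).2
  rw [hα] at h3
  rcases (Nat.Prime.dvd_mul Nat.prime_three).1 h3 with h | h
  · have := (Nat.Prime.dvd_of_dvd_pow Nat.prime_three h)
    omega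
  · exact hm h

/-- **Fité–Shparlinski 2016, §6: «`L_{1,1} = L_{2,1} = L_{3,1} = ∅`»** — for a prime `p = 2^α 3^β + 1` with
`β ≤ 3`, `K_p = ∅`: every `Φ_{S_k}` (`k ≠ 0, −1`, `ord k ≠ 3`) is nondegenerate.  Printed proof: the resultant
prime sets `L_{2,1,1,1} = {3}`, `L_{3,2,1,1} = L_{3,1,1,1} = {3, 271}`, «`K_3 = 0` and `271` is not of the form
`2^α 3³ + 1`»; here: a degenerate `k` has `N_k` odd, `N_k ∣ 3^β ∣ 27`, while `N_k ≥ 27` ([FGL] Remark 4.12,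
tree `le_lcm_orderOf_of_degenerate`) and `N_k = 27 ⟹ p = 271` (tree `eq_271_of_lcm_orderOf_eq`), `270 ≠ 2^α 3^β`.
[cite: FiteShparlinski2016, §6] [cite: FiteGonzalezLario2016, Remark 4.12] -/
theorem isNondegenerate_fermat_of_sub_one_eq_two_pow_mul_three_pow {a : ZMod p} (ha : a ≠ 0) (ha1 : 1 + a ≠ 0)
    (h3 : orderOf a ≠ 3) {α β : ℕ} (hβ : β ≤ 3) (hα : p - 1 = 2 ^ α * 3 ^ β)
    {hS : ∀ c : ZMod p, c.val.Coprime p → (c ∈ fermatCMType p 1 a (-1 - a) ↔ -c ∉ fermatCMType p 1 a (-1 - a))} :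
    IsNondegenerate (cmTypeOfResidues (L := L) (fermatCMType p 1 a (-1 - a)) hS) := by
  rw [isNondegenerate_fermat_iff_orderOf L ha ha1]
  intro hcond
  have hb : Odd (orderOf (-a ^ 2 - a)) ∧ Odd (orderOf a) := ⟨hcond.1, hcond.2.1⟩
  have hdvd := lcm_orderOf_dvd_of_sub_one_eq ha ha1 hb hα
  have h27 : Nat.lcm (orderOf (-a ^ 2 - a)) (orderOf a) ∣ 27 :=
    dvd_trans hdvd (by interval_cases β <;> norm_num)
  have hle := Nat.le_of_dvd (by norm_num) h27
  have hge := le_lcm_orderOf_of_degenerate ha ha1 h3 hb hcond.2.2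
  have h271 := eq_271_of_lcm_orderOf_eq ha ha1 h3 hb hcond.2.2 (le_antisymm hle hge)
  subst h271
  -- `270 = 2^α 3^β` is impossible (`5 ∣ 270`)
  have h5 : 5 ∣ 2 ^ α * 3 ^ β := by rw [← hα]; norm_num
  rcases (Nat.Prime.dvd_mul (by norm_num : Nat.Prime 5)).1 h5 with h | h
  · have := Nat.Prime.dvd_of_dvd_pow (by norm_num : Nat.Prime 5) h
    omega
  · have := Nat.Prime.dvd_of_dvd_pow (by norm_num : Nat.Prime 5) h
    omega

end FiteShparlinski

/-! ## §7 Erratum: «every prime `ℓ ≡ 7 (mod 12)` distinct from `7` and `19` is degenerate» is false as printed -/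

section Erratum

variable {p : ℕ} [hp : Fact p.Prime] (L : Type) [Field L] [NumberField L] [IsCyclotomicExtension {p} ℚ L]

/-- **Counterexamples to Fité–Shparlinski Corollary 3 (arXiv:1404.5178v1) / the penultimate sentence of [FGL]
Remark 3.4 (arXiv:1403.0807v2) as printed**
(«For every prime `ℓ ≡ 7 (mod 12)` distinct from `7` and `19` we have `#K_ℓ > 0`»; «every prime `ℓ ≡ 7
(mod 12)` distinct from `7` and `19` is degenerate (see [FS15])»): the primes `31, 43, 79, 103 ≡ 7 (mod 12)` have
`K_ℓ = ∅` — every `Φ_{S_k}` (`k ≠ 0, −1`, `ord k ≠ 3`) of `ℚ(ζ_ℓ)` is nondegenerate, by [FGL]'s own Remark 3.4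
list of the degenerate primes below `400` (tree `isNondegenerate_fermat_of_not_mem`).  (The arXiv proof of Cor. 3
searches only the primes `2·3^β + 1`; Lenstra's qualitative statement «`K_ℓ ≠ ∅` for every SUFFICIENTLY LARGE
`ℓ ≡ 7 (mod 12)`» [Greenberg 1980] and Cor. 2 are not affected and not formalised here.)
[cite: FiteShparlinski2016, Cor. 3] [cite: FiteGonzalezLario2016, Remark 3.4] -/
theorem isNondegenerate_fermat_of_mem_counterexamples (hmem : p ∈ ({31, 43, 79, 103} : Finset ℕ))
    {a : ZMod p} (ha : a ≠ 0) (ha1 : 1 + a ≠ 0) (h3 : orderOf a ≠ 3)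
    {hS : ∀ c : ZMod p, c.val.Coprime p → (c ∈ fermatCMType p 1 a (-1 - a) ↔ -c ∉ fermatCMType p 1 a (-1 - a))} :
    p % 12 = 7 ∧ IsNondegenerate (cmTypeOfResidues (L := L) (fermatCMType p 1 a (-1 - a)) hS) := by
  simp only [Finset.mem_insert, Finset.mem_singleton] at hmem
  refine ⟨by omega, isNondegenerate_fermat_of_not_mem L (by omega) ?_ ha ha1 h3⟩
  simp only [Finset.mem_insert, Finset.mem_singleton]
  omega

omit hp L in
/-- **The printed Corollary 3 is false**: there is a prime `p ≡ 7 (mod 12)`, `p ≠ 7, 19` (namely `p = 31`, the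
least one), all of whose Fermat types `Φ_{S_k}` (`k ≠ 0, −1`, `ord k ≠ 3`) are NONdegenerate, i.e. `K_p = ∅`
(tree `isNondegenerate_fermat_of_lt`: `67` is the least degenerate prime).
[cite: FiteShparlinski2016, Cor. 3] [cite: FiteGonzalezLario2016, Remark 3.4] -/
theorem exists_prime_mod_twelve_eq_seven_forall_isNondegenerate :
    ∃ (p : ℕ) (_ : Fact p.Prime), p % 12 = 7 ∧ p ≠ 7 ∧ p ≠ 19 ∧
      ∀ (L : Type) [Field L] [NumberField L] [IsCyclotomicExtension {p} ℚ L]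
        (a : ZMod p) (ha : a ≠ 0) (ha1 : 1 + a ≠ 0), orderOf a ≠ 3 →
        IsNondegenerate (cmTypeOfResidues (L := L) (fermatCMType p 1 a (-1 - a)) (fermatCMType_one_cm ha ha1)) := by
  haveI h31 : Fact (Nat.Prime 31) := ⟨by norm_num⟩
  exact ⟨31, h31, by norm_num, by norm_num, by norm_num,
    fun L _ _ _ a ha ha1 h3 => isNondegenerate_fermat_of_lt L ha ha1 h3 (by norm_num)⟩

/-- **Corollary 3, CORRECTED below `400`.** For a prime `p < 400` with `p ≡ 7 (mod 12)`: `K_p ≠ ∅` (some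
`Φ_{S_k}`, `k ≠ 0, −1`, `ord k ≠ 3`, is degenerate) iff `p = 67` or `p ≥ 127`; i.e. the exceptions below `400`
are exactly `7, 19, 31, 43, 79, 103` (not only `7, 19`).  From [FGL] Remark 3.4 as PROVED in the tree
(`exists_not_isNondegenerate_fermat_iff`): the primes `≡ 7 (mod 12)` in `[127, 400)` are
`127, 139, 151, 163, 199, 211, 223, 271, 283, 307, 331, 367, 379`, all listed.
[cite: FiteShparlinski2016, Cor. 3] [cite: FiteGonzalezLario2016, Remark 3.4] -/
theorem exists_not_isNondegenerate_fermat_iff_of_mod_twelve (hp400 : p < 400) (h12 : p % 12 = 7) :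
    (∃ a : ZMod p, ∃ (ha : a ≠ 0) (ha1 : 1 + a ≠ 0), orderOf a ≠ 3 ∧
        ¬ IsNondegenerate (cmTypeOfResidues (L := L) (fermatCMType p 1 a (-1 - a)) (fermatCMType_one_cm ha ha1))) ↔
      (p = 67 ∨ 127 ≤ p) := by
  rw [exists_not_isNondegenerate_fermat_iff L hp400]
  have hprime : p.Prime := hp.out
  constructor
  · intro hmem
    simp only [Finset.mem_insert, Finset.mem_singleton] at hmem
    omega
  · rintro (rfl | hge)
    · decide
    · -- `p = 12 q + 7` with `10 ≤ q ≤ 32`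
      obtain ⟨q, rfl⟩ : ∃ q, p = 12 * q + 7 := ⟨p / 12, by omega⟩
      have hq1 : 10 ≤ q := by omega
      have hq2 : q ≤ 32 := by omega
      interval_cases q <;> first | decide | (exfalso; revert hprime; norm_num)

end Erratum

/-! ## §8 Fité–Shparlinski's candidate primes `2·3^β + 1`: `K_ℓ ≠ ∅` at `163, 487, 1459, 39367`; `K_7 = K_19 = ∅` -/

section Candidates

variable {p : ℕ} [hp : Fact p.Prime] (L : Type) [Field L] [NumberField L] [IsCyclotomicExtension {p} ℚ L]

/-- From explicit `3`-power orders to degeneracy: if `ord k = 3^(i+2)` and `ord(−k²−k) = 3^j` with `j ≤ i + 1`,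
then (ii) and (iii) of Lemma 6 hold, so `Φ_{S_k}` is degenerate ([FGL] Thm. 4.10).
[cite: FiteShparlinski2016, Lemma 6] [cite: FiteGonzalezLario2016, Thm. 4.10] -/
theorem not_isNondegenerate_fermat_of_orderOf_eq_three_pow {a : ZMod p} (ha : a ≠ 0) (ha1 : 1 + a ≠ 0)
    {i j : ℕ} (hk : orderOf a = 3 ^ (i + 2)) (hh : orderOf (-a ^ 2 - a) = 3 ^ j) (hij : j ≤ i + 1)
    {hS : ∀ c : ZMod p, c.val.Coprime p → (c ∈ fermatCMType p 1 a (-1 - a) ↔ -c ∉ fermatCMType p 1 a (-1 - a))} :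
    orderOf a ≠ 3 ∧ ¬ IsNondegenerate (cmTypeOfResidues (L := L) (fermatCMType p 1 a (-1 - a)) hS) := by
  refine ⟨?_, ?_⟩
  · rw [hk]
    intro h
    have : 3 ^ (i + 2) ≤ 3 ^ 1 := by rw [pow_one]; exact h.le
    have := (Nat.pow_le_pow_iff_right (by norm_num : 1 < 3)).1 this
    omega
  · rw [isNondegenerate_fermat_iff_orderOf L ha ha1, not_not, hk, hh]
    refine ⟨Odd.pow (by decide), Odd.pow (by decide), ?_⟩
    rw [padicValNat.prime_pow, padicValNat.prime_pow]
    omega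

/-- `ℓ = 487 = 2·3⁵ + 1`: `ord 21 = 3⁵`, `ord(−21² − 21) = 3³`. [cite: FiteShparlinski2016, Cor. 3 (proof)] -/
private theorem data_487 : (21 : ZMod 487) ≠ 0 ∧ (1 : ZMod 487) + 21 ≠ 0 ∧
    orderOf (21 : ZMod 487) = 3 ^ (3 + 2) ∧ orderOf (-(21 : ZMod 487) ^ 2 - 21) = 3 ^ 3 := by
  refine ⟨by decide, by decide, ?_, ?_⟩ <;> apply orderOf_eq_prime_pow <;> decide +kernel

/-- `ℓ = 1459 = 2·3⁶ + 1`: `ord 16 = 3⁵`, `ord(−16² − 16) = 3²`. [cite: FiteShparlinski2016, Cor. 3 (proof)] -/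
private theorem data_1459 : (16 : ZMod 1459) ≠ 0 ∧ (1 : ZMod 1459) + 16 ≠ 0 ∧
    orderOf (16 : ZMod 1459) = 3 ^ (3 + 2) ∧ orderOf (-(16 : ZMod 1459) ^ 2 - 16) = 3 ^ 2 := by
  refine ⟨by decide, by decide, ?_, ?_⟩ <;> apply orderOf_eq_prime_pow <;> decide +kernel

/-- `ℓ = 39367 = 2·3⁹ + 1`: `ord 1901 = 3⁹`, `ord(−1901² − 1901) = 3²`. [cite: FiteShparlinski2016, Cor. 3 (proof)] -/
private theorem data_39367 : (1901 : ZMod 39367) ≠ 0 ∧ (1 : ZMod 39367) + 1901 ≠ 0 ∧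
    orderOf (1901 : ZMod 39367) = 3 ^ (7 + 2) ∧ orderOf (-(1901 : ZMod 39367) ^ 2 - 1901) = 3 ^ 2 := by
  refine ⟨by decide, by decide, ?_, ?_⟩ <;> apply orderOf_eq_prime_pow <;> decide +kernel

/-- **Fité–Shparlinski, proof of Cor. 3: «A computer search establishes that the only primes of this form are
`7, 19, 163, 487, 1459, 39367, 86093443, 258280327`.  Among the above primes, we have `#K_ℓ = 0` only for
`ℓ = 7, 19`» — CERTIFIED for `ℓ ∈ {163, 487, 1459, 39367}`** (`163`: [FGL] Remark 3.4 list; `487`, `1459`, `39367`: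
witnesses `k = 21, 16, 1901` with `ord k = 3⁵, 3⁵, 3⁹`, `ord(−k²−k) = 3³, 3², 3²`); `K_7 = K_19 = ∅` is the tree's
`isNondegenerate_fermat_of_lt`.  NOT certified here: `86093443 = 2·3¹⁶ + 1`, `258280327 = 2·3¹⁷ + 1` (every
witness has `ord k ≥ 3¹¹`, beyond kernel evaluation). [cite: FiteShparlinski2016, Cor. 3 (proof)] -/
theorem exists_not_isNondegenerate_fermat_of_mem_candidates (hmem : p ∈ ({163, 487, 1459, 39367} : Finset ℕ)) :
    ∃ a : ZMod p, ∃ (ha : a ≠ 0) (ha1 : 1 + a ≠ 0), orderOf a ≠ 3 ∧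
      ¬ IsNondegenerate (cmTypeOfResidues (L := L) (fermatCMType p 1 a (-1 - a)) (fermatCMType_one_cm ha ha1)) := by
  simp only [Finset.mem_insert, Finset.mem_singleton] at hmem
  rcases hmem with rfl | rfl | rfl | rfl
  · exact (exists_not_isNondegenerate_fermat_iff L (by norm_num)).2 (by decide)
  · obtain ⟨h0, h1, hk, hh⟩ := data_487
    exact ⟨21, h0, h1, not_isNondegenerate_fermat_of_orderOf_eq_three_pow L h0 h1 hk hh (by norm_num)⟩
  · obtain ⟨h0, h1, hk, hh⟩ := data_1459
    exact ⟨16, h0, h1, not_isNondegenerate_fermat_of_orderOf_eq_three_pow L h0 h1 hk hh (by norm_num)⟩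
  · obtain ⟨h0, h1, hk, hh⟩ := data_39367
    exact ⟨1901, h0, h1, not_isNondegenerate_fermat_of_orderOf_eq_three_pow L h0 h1 hk hh (by norm_num)⟩

/-- **«we have `#K_ℓ = 0` … for `ℓ = 7, 19`»**: every `Φ_{S_k}` (`k ≠ 0, −1`, `ord k ≠ 3`) of `ℚ(ζ₇)` and of
`ℚ(ζ₁₉)` is nondegenerate (tree: `67` is the least degenerate prime). [cite: FiteShparlinski2016, Cor. 3 (proof)] -/
theorem isNondegenerate_fermat_seven_nineteen (h : p = 7 ∨ p = 19) {a : ZMod p} (ha : a ≠ 0) (ha1 : 1 + a ≠ 0)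
    (h3 : orderOf a ≠ 3)
    {hS : ∀ c : ZMod p, c.val.Coprime p → (c ∈ fermatCMType p 1 a (-1 - a) ↔ -c ∉ fermatCMType p 1 a (-1 - a))} :
    IsNondegenerate (cmTypeOfResidues (L := L) (fermatCMType p 1 a (-1 - a)) hS) :=
  isNondegenerate_fermat_of_lt L ha ha1 h3 (by omega)

end Candidates

end CyclotomicFermatCMType

end Literature.AlgebraicGeometry.ComplexMultiplication
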